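import Summits.BirchSwinnertonDyer.BirchSwinnertonDyer.Theorems.PrintCf2RamifiedOffTYZMoverSumBlocksSix
import Summits.BirchSwinnertonDyer.BirchSwinnertonDyer.Theorems.PrintCf2RamifiedOffTYZGaloisMotionDoorEven
import HarnessLib

/-!
# Crux `PrintCf2.RamifiedOffTYZOfFacts` (stmt-BirchSwinnertonDyer-20509), line `offtyz-v7`, LEAD cycle 10 (cruxlead-20509 g9):
# THE `s = 1` STRATUM OF THE RESIDUAL FOR `n ≡ 6 (mod 8)` — A GALOIS MOVER OF THE GENUS POINT EXISTS whenever `#Sel₂(E_n) = 8`, the kernel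
# class of Monsky's even matrix has `adj(M_even)_{(inl i)(inr i)} = 1` for some `i`, and the even blocks through `pᵢ` are in the genus regime;
# hence (even door p677864) `ord_{s=1} L(E_n, s) = rank E_n(ℚ) = 1`, `Ш(E_n)[2^∞] = 0`, `BSD(E_n, 2)`

THEOREMS ONLY (no `def`, no named fact, no `sorry`), `--supports stmt-BirchSwinnertonDyer-20509` (the `s = 1`, `n ≡ 6 (8)` stratum of item 23432
`RamifiedOffJumpOneOfFacts`; even companion of g7's `…SelmerRankOneMover` (p691170) and g8's `…SelmerRankOneMoverSeven` (p699120); programme F3 of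
the crux workfile `Lines/offtyz_v7_SevenSector.md` §9–§10).

THE ASSEMBLY.  `n = 2p₁⋯p_k`, `p₁⋯p_k ≡ 3 (mod 4)`.  By Kummer theory inside `ℍ′_n` (`MoverAssembly.exists_aut_im_bits_eq`, p698643) there is an
automorphism `h` fixing `i`, moving `i√−2` and `i√−pᵢ` and fixing every other `i√−p_j` (§1).  By the even block sum (`sqMover_six_of_adjugate_eq_one`,
previous file) the `τ(1)`-coefficient of `(hh)·P(n) − P(n)` is `adj(M_even)_{(inl i)(inr i)}`, so `hh` MOVES `P(n)` when that cofactor is `1` (§2);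
`hh` fixes `i` and every `√−d`, and the even Galois-mover door (`GaloisMotion.rankOne_sha_bsdp_two_congruentNumberCurve_of_selmerEight_of_mover_even`,
p677864: TYZ Thm 3.5 main clause + Lemma 3.18 + `#Sel₂ = 8`) gives the four conclusions (§3).  For `#Sel₂(E_n) = 8` the kernel of `M_even` is a line
`{0, u}` (Monsky's exact even formula, tree theorem) and `adj(M_even)_{(inl i)(inr i)} = u_{inl i}` (§2: `adj M = u (Ju)ᵀ`), so the cofactor hypothesis
reads «the Selmer class has a non-zero FIRST block» (numerically: always, when the 4-rank of `Cl(ℚ(√−n))` vanishes — LEAD g8 census, 1368/1368; the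
class-group form is the successor's task).
HYPOTHESES (all printed statements except the genus-regime / cofactor conditions, which are decidable invariants of `n`): the genus-point data `D` with
`recursion`, `thm35Main`, `scriptLSpec`, `lemma318`; the CM-point layer on every block with ONE complex conjugation; the lift `θ_d` of `σ_{1+ϖ}` and the
conductor-`4` Frobenius clause (Prop. 3.2 (2) + Cox Lemma 5.19 / §9.A — not yet a typed named fact, hence displayed) on every block `d ≡ 6 (mod 8)`;
TYZ Thm 1.1.  BSD is not proved by any of this; no class is closed by this file (a conditional result toward item 23432).

References: [cite: TianYuanZhang2017, Thm. 1.1, §3.1 (p0011 L1–L73), Prop. 3.2 (2), Thm. 3.5, Thm. 3.6 (2), Lemma 3.18, proof of Lemma 3.21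
(p0020 L27–L63)]; [cite: HeathBrown1994SelmerCongruentII, Appendix (Monsky), typescript p. 41 L20–L36]; [cite: Smith2016CongruentDensity, Thm. 1.2];
[cite: Cox2013, §5.C Lemma 5.19, §9.A]; [cite: HornJohnson2013, §0.8.2]; crux notes `Lines/offtyz_v7_SevenSector.md` §9–§10.
-/

noncomputable section

open scoped Classical NumberField

open WeierstrassCurve WeierstrassCurve.Affine Finset Matrix Literature.NumberTheory.EllipticCurves
  Literature.NumberTheory.EllipticCurves.TianYuanZhang2017
  Literature.NumberTheory.EllipticCurves.TianYuanZhang2017.W2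
  Literature.NumberTheory.EllipticCurves.HeathBrown1994
  Literature.NumberTheory.EllipticCurves.HeathBrown1994.Families
  Literature.NumberTheory.EllipticCurves.Smith2016
  Literature.NumberTheory.EllipticCurves.MonskySelmerParity
  Literature.NumberTheory.QuadraticFields.RingClass
  Literature.NumberTheory.QuadraticFields
  Literature.LinearAlgebra.Matrix
  Summit.BirchSwinnertonDyer.Rank1Residual.P2.GenusPeriodTransferLayer
  Summit.BirchSwinnertonDyer.PrintCf2.QForm
  Summit.BirchSwinnertonDyer.PrintCf2.QFormForest

set_option autoImplicit false

namespace Summit.BirchSwinnertonDyer.PrintCf2.MoverAssembly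

variable {k : ℕ} (p : Fin k → ℕ) (hp : ∀ i, (p i).Prime) (hodd : ∀ i, Odd (p i)) (hinj : Function.Injective p)
variable {n : ℕ} (D : GenusPointData n)

/-! ## §1 The Kummer element pointed at `pᵢ` -/

include hp hodd hinj in
/-- **The Kummer element exists**: for `n = 2p₁⋯p_k` and every `i` there is an automorphism `h` of `ℍ′_n` fixing `i`, moving `i√−2` and `i√−pᵢ`, and
fixing `i√−p_j` for `j ≠ i` (bit surjectivity of `Aut_ℚ(ℍ′_n)` on `(i; i√−2, i√−p₁, …, i√−p_k)`, p698643).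
[cite: TianYuanZhang2017, proof of Lemma 3.21 (p0020 L55–L58)] [cite: Cox2013, Thm. 6.1] -/
theorem exists_kummer_element (hn : n = 2 * ∏ i, p i) (i : Fin k) :
    ∃ h : D.H ≃ₐ[ℚ] D.H, h D.im = D.im ∧ h (D.im * D.sqrtNeg 2) ≠ D.im * D.sqrtNeg 2 ∧
      ∀ j, h (D.im * D.sqrtNeg (p j)) = D.im * D.sqrtNeg (p j) ↔ j ≠ i := by
  have hn0 : n ≠ 0 := by rw [hn]; exact mul_ne_zero two_ne_zero (Finset.prod_ne_zero_iff.mpr fun i _ => (hp i).ne_zero)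
  have hnn : n ∈ n.divisors := Nat.mem_divisors_self n hn0
  have hprod : ∏ l, (Fin.cons 2 p : Fin (k + 1) → ℕ) l = n := by rw [prod_cons_two_eq p, hn]
  have hQn : ∀ l, (Fin.cons 2 p : Fin (k + 1) → ℕ) l ∈ n.divisors := mem_divisors_of_block (Fin.cons 2 p) hnn hprod
  obtain ⟨h, h0, hbits⟩ := exists_aut_im_bits_eq D (Fin.cons 2 p) (prime_cons_two p hp) (injective_cons_two p hodd hinj) hQn 0
    (Fin.cons 1 (fun j => if j = i then 1 else 0))
  refine ⟨h, ?_, ?_, fun j => ?_⟩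
  · by_contra hne; rw [if_neg hne] at h0; exact one_ne_zero h0
  · have h2 := hbits 0
    simp only [Fin.cons_zero] at h2
    intro heq; rw [if_pos heq] at h2; exact zero_ne_one h2
  · have hj := hbits j.succ
    simp only [Fin.cons_succ] at hj
    by_cases hji : j = i
    · rw [if_pos hji] at hj
      constructor
      · intro heq; rw [if_pos heq] at hj; exact absurd hj zero_ne_one
      · intro hne; exact absurd hji hne
    · rw [if_neg hji] at hj
      constructor
      · intro _; exact hji
      · intro _; by_contra hne; rw [if_neg hne] at hj; exact one_ne_zero hj

/-! ## §2 The kernel line of Monsky's even matrix and its `(inl i, inr i)` cofactors -/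

include hp hodd hinj in
/-- **`#Sel₂(E_{2m}) = 8 ⟹ #ker M_even = 2`** (Monsky's exact even formula `#Sel₂ = 2^{2+s}`, `s = 2k − rank M_even`, tree theorem).
[cite: HeathBrown1994SelmerCongruentII, Appendix (Monsky), typescript p. 38 L17 – p. 41 L36] -/
theorem card_ker_monskyEven_eq_two_of_card_selmer_eight (hsel : Nat.card ((congruentNumberCurve (2 * ∏ i, p i)).selmerGroup 2) = 8) :
    Fintype.card {v : Fin k ⊕ Fin k → ZMod 2 // monskyMatrixEven p *ᵥ v = 0} = 2 := by
  rw [monsky_card_selmerGroup_two_even_holds k p hp hodd hinj, show (8 : ℕ) = 2 ^ 3 by norm_num] at hsel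
  have hs : monskySelmerRankEven p = 1 := by
    have := Nat.pow_right_injective le_rfl hsel; omega
  have hrank : (monskyMatrixEven p).rank ≤ 2 * k := by
    have h := Matrix.rank_le_card_width (monskyMatrixEven p)
    rwa [Fintype.card_sum, Fintype.card_fin, ← two_mul] at h
  rw [card_ker_mulVec_eq_pow, Fintype.card_sum, Fintype.card_fin, ← two_mul]
  rw [monskySelmerRankEven] at hs
  rw [show 2 * k - (monskyMatrixEven p).rank = 1 by omega, pow_one]

/-- **`M_evenᵀ = J·M_even·J`** for the block swap `J` (`[[Aᵀ+D₂, D₋₁],[D₂, A+D₂]]ᵀ = [[A+D₂, D₂],[D₋₁, Aᵀ+D₂]]`).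
[cite: HeathBrown1994SelmerCongruentII, Appendix (Monsky), typescript p. 41 L20–L36] -/
theorem monskyMatrixEven_transpose_eq_submatrix :
    (monskyMatrixEven p)ᵀ = (monskyMatrixEven p).submatrix Sum.swap Sum.swap := by
  ext (a | a) (b | b)
  · rw [transpose_apply, submatrix_apply, Sum.swap_inl, Sum.swap_inl, monskyMatrixEven, fromBlocks_apply₁₁, fromBlocks_apply₂₂,
      Matrix.add_apply, Matrix.add_apply, transpose_apply, legendreDiagonal, diagonal_apply, diagonal_apply]
    by_cases hab : a = b
    · subst hab; rfl
    · rw [if_neg (Ne.symm hab), if_neg hab]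
  · rw [transpose_apply, submatrix_apply, Sum.swap_inl, Sum.swap_inr, monskyMatrixEven, fromBlocks_apply₂₁, fromBlocks_apply₂₁,
      legendreDiagonal, diagonal_apply, diagonal_apply]
    by_cases hab : a = b
    · subst hab; rfl
    · rw [if_neg (Ne.symm hab), if_neg hab]
  · rw [transpose_apply, submatrix_apply, Sum.swap_inr, Sum.swap_inl, monskyMatrixEven, fromBlocks_apply₁₂, fromBlocks_apply₁₂,
      legendreDiagonal, diagonal_apply, diagonal_apply]
    by_cases hab : a = b
    · subst hab; rfl
    · rw [if_neg (Ne.symm hab), if_neg hab]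
  · rw [transpose_apply, submatrix_apply, Sum.swap_inr, Sum.swap_inr, monskyMatrixEven, fromBlocks_apply₂₂, fromBlocks_apply₁₁,
      Matrix.add_apply, Matrix.add_apply, transpose_apply, legendreDiagonal, diagonal_apply, diagonal_apply]
    by_cases hab : a = b
    · subst hab; rfl
    · rw [if_neg (Ne.symm hab), if_neg hab]

/-- **The swapped kernel vector is a LEFT null vector**: `M u = 0 ⟹ (u ∘ swap) ᵥ* M = 0` (`Mᵀ = J M J`).
[cite: HeathBrown1994SelmerCongruentII, Appendix (Monsky), typescript p. 41 L20–L36] -/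
theorem swap_vecMul_monskyMatrixEven_eq_zero {u : Fin k ⊕ Fin k → ZMod 2} (hu : monskyMatrixEven p *ᵥ u = 0) :
    (fun c => u (Sum.swap c)) ᵥ* monskyMatrixEven p = 0 := by
  rw [← mulVec_transpose, monskyMatrixEven_transpose_eq_submatrix]
  funext r
  rw [Pi.zero_apply, mulVec, dotProduct]
  have h := congrFun hu (Sum.swap r)
  rw [Pi.zero_apply, mulVec, dotProduct] at h
  rw [← h]
  exact Fintype.sum_equiv (Equiv.sumComm (Fin k) (Fin k)) _ _ (fun c => by rw [submatrix_apply]; rfl)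

include hp hodd hinj in
/-- **`adj(M_even)_{(inl i)(inr i)} = u_{inl i}`** for the kernel generator `u = kerSum M_even` when `#Sel₂(E_{2m}) = 8`: the columns of `adj M` lie in
the kernel line `{0, u}`, its rows in the left kernel line `{0, u∘swap}`, and `adj M ≠ 0`; so `adj M = u·(u∘swap)ᵀ` and the `(inl i, inr i)` entry is
`u_{inl i} · u_{inl i} = u_{inl i}`. [cite: HornJohnson2013, §0.8.2 (adjugate of a matrix of rank n − 1)] -/
theorem adjugate_monskyEven_inl_inr_eq_kerSum (hsel : Nat.card ((congruentNumberCurve (2 * ∏ i, p i)).selmerGroup 2) = 8) (i : Fin k) :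
    (monskyMatrixEven p).adjugate (Sum.inl i) (Sum.inr i) = kerSum (monskyMatrixEven p) (Sum.inl i) := by
  set M := monskyMatrixEven p with hM
  have hcard := card_ker_monskyEven_eq_two_of_card_selmer_eight p hp hodd hinj hsel
  obtain ⟨hne, hker⟩ := ker_iff_of_card_eq_two M hcard
  set u := kerSum M with hu
  have hMu : M *ᵥ u = 0 := (hker u).mpr (Or.inr rfl)
  have hdet : M.det = 0 := Matrix.exists_mulVec_eq_zero_iff.mp ⟨u, hne, hMu⟩
  -- left kernel line: `x ᵥ* M = 0 ⟹ x = 0 ∨ x = u ∘ swap`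
  have hcardT : Fintype.card {v : Fin k ⊕ Fin k → ZMod 2 // Mᵀ *ᵥ v = 0} = 2 := by rw [card_ker_transpose, hcard]
  obtain ⟨hneT, hkerT⟩ := ker_iff_of_card_eq_two Mᵀ hcardT
  have huT : Mᵀ *ᵥ (fun c => u (Sum.swap c)) = 0 := by rw [mulVec_transpose]; exact swap_vecMul_monskyMatrixEven_eq_zero p hMu
  have huT0 : (fun c => u (Sum.swap c)) ≠ 0 := by
    intro h0; apply hne; funext c
    have := congrFun h0 (Sum.swap c); simp only [Sum.swap_swap, Pi.zero_apply] at this; exact this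
  have hlineT : kerSum Mᵀ = fun c => u (Sum.swap c) := by
    rcases (hkerT _).mp huT with h | h
    · exact absurd h huT0
    · exact h.symm
  have hleft : ∀ x : Fin k ⊕ Fin k → ZMod 2, x ᵥ* M = 0 → x = 0 ∨ x = fun c => u (Sum.swap c) := by
    intro x hx; rw [← hlineT]; exact (hkerT x).mp (by rw [mulVec_transpose]; exact hx)
  -- `adj M ≠ 0`
  have hadj : M.adjugate ≠ 0 := by
    refine adjugate_ne_zero_of_vecMul_line M (fun c => u (Sum.swap c)) (fun x hx => ?_) (Sum.inl i)
    rcases hleft x hx with h | h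
    · exact ⟨0, by rw [h, zero_smul]⟩
    · exact ⟨1, by rw [h, one_smul]⟩
  -- columns in `{0, u}`, rows in `{0, u∘swap}`
  have hcol : ∀ j, (fun r => M.adjugate r j) = 0 ∨ (fun r => M.adjugate r j) = u := fun j => (hker _).mp (mulVec_adjugate_col M hdet j)
  have hrow : ∀ r, (fun j => M.adjugate r j) = 0 ∨ (fun j => M.adjugate r j) = fun c => u (Sum.swap c) :=
    fun r => hleft _ (adjugate_row_vecMul M hdet r)
  -- a non-zero entry exists; there the row is `u∘swap` and the column is `u`
  obtain ⟨r₀, j₀, h00⟩ : ∃ r j, M.adjugate r j ≠ 0 := by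
    by_contra hall; push Not at hall; exact hadj (Matrix.ext fun r j => hall r j)
  have hrow₀ : (fun j => M.adjugate r₀ j) = fun c => u (Sum.swap c) := by
    rcases hrow r₀ with h | h
    · exact absurd (congrFun h j₀) h00
    · exact h
  -- entry `(r, j)` is `u r · u (swap j)` in general: first the column `inr i`
  by_cases hui : u (Sum.inl i) = 0
  · -- then the column `inr i` vanishes at `r₀`, hence is the zero column
    have h0 : M.adjugate r₀ (Sum.inr i) = 0 := by
      have := congrFun hrow₀ (Sum.inr i); simp only [Sum.swap_inr] at this; rw [this, hui]
    rcases hcol (Sum.inr i) with h | h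
    · rw [hui]; exact congrFun h (Sum.inl i)
    · -- column `inr i` equals `u`, so `u r₀ = 0`; but row `r₀` is `u∘swap ≠ 0` forces... use the column `j₀` instead
      have hur₀ : u r₀ = 0 := by rw [← congrFun h r₀]; exact h0
      rcases hcol j₀ with hc | hc
      · exact absurd (congrFun hc r₀) h00
      · exact absurd ((congrFun hc r₀).trans hur₀) h00
  · -- `u (inl i) = 1`: the row `inl i` of `adj M` is non-zero... via the column `j₀`
    have hu1 : u (Sum.inl i) = 1 := by
      rcases (by decide : ∀ x : ZMod 2, x = 0 ∨ x = 1) (u (Sum.inl i)) with h | h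
      · exact absurd h hui
      · exact h
    -- the column `j₀` is `u` (it is non-zero at `r₀`), so the entry `(inl i, j₀)` is `1`, so the row `inl i` is `u∘swap`
    have hcol₀ : (fun r => M.adjugate r j₀) = u := by
      rcases hcol j₀ with h | h
      · exact absurd (congrFun h r₀) h00
      · exact h
    have hi0 : M.adjugate (Sum.inl i) j₀ ≠ 0 := by
      rw [congrFun hcol₀ (Sum.inl i), hu1]; exact one_ne_zero
    have hrowi : (fun j => M.adjugate (Sum.inl i) j) = fun c => u (Sum.swap c) := by
      rcases hrow (Sum.inl i) with h | h
      · exact absurd (congrFun h j₀) hi0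
      · exact h
    have := congrFun hrowi (Sum.inr i)
    simp only [Sum.swap_inr] at this
    rw [this]

/-! ## §3 The mover and the door -/

include hp hodd hinj in
/-- **A SQUARE MOVER OF `P(n)` EXISTS** for `n = 2p₁⋯p_k ≡ 6 (mod 8)` when `adj(M_even)_{(inl i)(inr i)} = 1` for some `i` whose even blocks of odd
cofactor parity are in the genus regime (hypotheses as in `sqMover_six_of_adjugate_eq_one`): there is `h` with `(hh)·P(n) ≠ P(n)`.
[cite: TianYuanZhang2017, §3.1 (p0011 L53–L73), Prop. 3.2 (2), Thm. 3.6 (2), proof of Lemma 3.21 (p0020 L27–L63), Thm. 1.1] -/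
theorem exists_sq_mover_six (hn : n = 2 * ∏ i, p i) (h3 : (∏ i, p i) % 4 = 3) (hrec : D.recursion) (hLs : D.scriptLSpec)
    (z : ℕ → APoint D.H) (Φ : ℕ → Finset (D.H ≃ₐ[ℚ] D.H)) (ΓH ΓH' : ℕ → Subgroup (D.H ≃ₐ[ℚ] D.H))
    (σ θ : ℕ → (D.H ≃ₐ[ℚ] D.H)) (c : D.H ≃ₐ[ℚ] D.H) (hc : D.ConjSpec c)
    (hblock : ∀ d ∈ n.divisors, ((d % 8 = 5 ∨ d % 8 = 6) → D.CMBlockSpec d (z d) (Φ d) (ΓH d) (ΓH' d) (σ d) c) ∧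
      (d % 8 = 7 → D.SevenBlockSpec d))
    (htheta : ∀ d ∈ n.divisors, d % 8 = 6 → D.ThetaBlockSpec d (z d) (ΓH d) (ΓH' d) (σ d) (θ d))
    (hFrob : ∀ d ∈ n.divisors, d % 8 = 6 → ∀ q : ℕ, q.Prime → q ∣ d → q ≠ 2 → ∃ φ : D.H ≃ₐ[ℚ] D.H,
      φ (D.sqrtNeg d) = D.sqrtNeg d ∧ φ * φ ∈ ΓH' d ∧ φ D.im = (jacobiSym (-1) q) • D.im ∧
        ∀ r : ℕ, r.Prime → r ∣ n → r ≠ q → φ (D.sqrtNeg r) = (jacobiSym (-(r : ℤ)) q) • D.sqrtNeg r)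
    (h11 : thm11_parity_of_scriptL) (i : Fin k)
    (hgenus : ∀ S : Finset (Fin k), i ∈ S → (∑ j ∈ S, addLegendreSym (-1) (p j)) = 1 → coblockWeight p S = 1 →
      Odd (gK (2 * ∏ j ∈ S, p j)) ∧
        Fintype.card {v : Fin S.card ⊕ Unit → ZMod 2 //
          (Matrix.fromBlocks (legendreMatrix (blockPrimes p S) + legendreDiagonal (blockPrimes p S) (-2))
            (Matrix.of fun j (_ : Unit) => addLegendreSym 2 (blockPrimes p S j))
            (0 : Matrix Unit (Fin S.card) (ZMod 2)) (0 : Matrix Unit Unit (ZMod 2))) *ᵥ v = 0} = 2)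
    (hadj : (monskyMatrixEven p).adjugate (Sum.inl i) (Sum.inr i) = 1) :
    ∃ h : D.H ≃ₐ[ℚ] D.H, D.galPt (h * h) (D.P n) ≠ D.P n := by
  obtain ⟨h, hhi, hh2, hhp⟩ := exists_kummer_element p hp hodd hinj D hn i
  exact ⟨h, sqMover_six_of_adjugate_eq_one p hp hodd hinj D hn h3 hrec hLs z Φ ΓH ΓH' σ θ c hc hblock htheta hFrob h11 i hgenus hhi hh2 hhp hadj⟩

include hp hodd hinj in
/-- **THE `s = 1` STRATUM FOR `n ≡ 6 (mod 8)` (mover sector), THROUGH THE EVEN DOOR.**  For `n = 2p₁⋯p_k` with `p₁⋯p_k ≡ 3 (mod 4)`,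
`#Sel⁽²⁾(E_n/ℚ) = 8`, some `i` with `adj(M_even)_{(inl i)(inr i)} = 1` whose even blocks `2d_S ∋ pᵢ` of odd cofactor parity are in the genus regime
(`g(2d_S)` odd, `#ker N_{2d_S} = 2`), granted the printed Tian–Yuan–Zhang §3 data on `n` (genus-point displays `recursion`, `thm35Main`, `scriptLSpec`,
`lemma318`; the CM-point layer on every block; the lift of `σ_{1+ϖ}` and the conductor-`4` Frobenius clause on every block `d ≡ 6 (mod 8)`) and Thm 1.1:
`ord_{s=1} L(E_n, s) = 1`, `rank E_n(ℚ) = 1`, `Ш(E_n/ℚ)[2^∞] = 0`, and `BSD(E_n, 2)` holds.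
[cite: TianYuanZhang2017, Thm. 1.1, §3.1, Prop. 3.2 (2), Thm. 3.5, Thm. 3.6 (2), Lemma 3.18, proof of Lemma 3.21]
[cite: HeathBrown1994SelmerCongruentII, Appendix (Monsky), typescript p. 41 L20–L36] [cite: Smith2016CongruentDensity, Thm. 1.2] [cite: Miller2011LMS, Def. 1.1] -/
theorem rankOne_sha_bsdp_two_of_card_selmer_eight_six (hn : n = 2 * ∏ i, p i) (h3 : (∏ i, p i) % 4 = 3)
    (hrec : D.recursion) (h35 : D.thm35Main) (hLs : D.scriptLSpec) (h318 : D.lemma318)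
    (z : ℕ → APoint D.H) (Φ : ℕ → Finset (D.H ≃ₐ[ℚ] D.H)) (ΓH ΓH' : ℕ → Subgroup (D.H ≃ₐ[ℚ] D.H))
    (σ θ : ℕ → (D.H ≃ₐ[ℚ] D.H)) (c : D.H ≃ₐ[ℚ] D.H) (hc : D.ConjSpec c)
    (hblock : ∀ d ∈ n.divisors, ((d % 8 = 5 ∨ d % 8 = 6) → D.CMBlockSpec d (z d) (Φ d) (ΓH d) (ΓH' d) (σ d) c) ∧
      (d % 8 = 7 → D.SevenBlockSpec d))
    (htheta : ∀ d ∈ n.divisors, d % 8 = 6 → D.ThetaBlockSpec d (z d) (ΓH d) (ΓH' d) (σ d) (θ d))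
    (hFrob : ∀ d ∈ n.divisors, d % 8 = 6 → ∀ q : ℕ, q.Prime → q ∣ d → q ≠ 2 → ∃ φ : D.H ≃ₐ[ℚ] D.H,
      φ (D.sqrtNeg d) = D.sqrtNeg d ∧ φ * φ ∈ ΓH' d ∧ φ D.im = (jacobiSym (-1) q) • D.im ∧
        ∀ r : ℕ, r.Prime → r ∣ n → r ≠ q → φ (D.sqrtNeg r) = (jacobiSym (-(r : ℤ)) q) • D.sqrtNeg r)
    (h11 : thm11_parity_of_scriptL) (i : Fin k)
    (hgenus : ∀ S : Finset (Fin k), i ∈ S → (∑ j ∈ S, addLegendreSym (-1) (p j)) = 1 → coblockWeight p S = 1 →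
      Odd (gK (2 * ∏ j ∈ S, p j)) ∧
        Fintype.card {v : Fin S.card ⊕ Unit → ZMod 2 //
          (Matrix.fromBlocks (legendreMatrix (blockPrimes p S) + legendreDiagonal (blockPrimes p S) (-2))
            (Matrix.of fun j (_ : Unit) => addLegendreSym 2 (blockPrimes p S j))
            (0 : Matrix Unit (Fin S.card) (ZMod 2)) (0 : Matrix Unit Unit (ZMod 2))) *ᵥ v = 0} = 2)
    (hadj : (monskyMatrixEven p).adjugate (Sum.inl i) (Sum.inr i) = 1)
    (hsel : haveI := isElliptic_congruentNumberCurve (show n ≠ 0 by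
        rw [hn]; exact mul_ne_zero two_ne_zero (Finset.prod_ne_zero_iff.mpr fun i _ => (hp i).ne_zero));
      Nat.card ((congruentNumberCurve n).selmerGroup 2) = 8) :
    haveI := isElliptic_congruentNumberCurve (show n ≠ 0 by
      rw [hn]; exact mul_ne_zero two_ne_zero (Finset.prod_ne_zero_iff.mpr fun i _ => (hp i).ne_zero))
    (congruentNumberCurve n).analyticRank = 1 ∧ (congruentNumberCurve n).mordellWeilRank = 1 ∧
      AddCommGroup.primaryComponent (congruentNumberCurve n).sha 2 = ⊥ ∧
      BSDp (congruentNumberCurve n) 2 := by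
  have hsq : Squarefree n := by
    rw [hn, ← prod_cons_two_eq p]
    exact squarefree_prod_of_injective _ (prime_cons_two p hp) (injective_cons_two p hodd hinj)
  have hmodd : Odd (∏ i, p i) := odd_prod p hp (ne_two_of_odd p hodd)
  have h6 : n % 8 = 6 := by rcases hmodd with ⟨r, hr⟩; omega
  obtain ⟨h, hmove⟩ := exists_sq_mover_six p hp hodd hinj D hn h3 hrec hLs z Φ ΓH ΓH' σ θ c hc hblock htheta hFrob h11 i hgenus hadj
  exact GaloisMotion.rankOne_sha_bsdp_two_congruentNumberCurve_of_selmerEight_of_mover_even hsq h6 hsel D h35 hLs h318 (h * h)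
    (mul_self_apply_im D h) (fun d hd => mul_self_apply_sqrtNeg D h hd) hmove

end Summit.BirchSwinnertonDyer.PrintCf2.MoverAssembly

end
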